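import Summits.BirchSwinnertonDyer.BirchSwinnertonDyer.Theorems.ResidualThetaTransportAtTwoUniversalNormTowerVanishing
import Literature.NumberTheory.EllipticCurves.Kato2004.IwasawaH1TowerLimitProofs
import Literature.NumberTheory.EllipticCurves.Kato2004.IwasawaH1ReductionPkSemilinear
import HarnessLib

/-!
# The `Λ`-adic road to SURJ⁺@2 (item 23110 at every rank) in FINITE-COEFFICIENT currency: doubly compatible families of
# classes `c_{n,k} ∈ C_{n,k} ⊆ H¹(ℚ_n, E[p^k])` in a `γ`-stable bounded-rank tower VANISH, and (Kőnig / Mittag-Leffler) every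
# transition `C_{j,j} → C_{n₀,k₀}` from a high enough level is the ZERO map — the input shape of the layer Poitou–Tate step

Routes `ResidualThetaTransportAtTwo` (RTT, crux r201 `ResidualLambdaFormulaNegDiscAtTwo`, stmt-BirchSwinnertonDyer-23110) /
`ThetaPartnerAtTwo` (K1 `stub_surj2`; K3 aside). Seat `prover-bsd-wall-tp2-p2x-w2` g14 (width of the K3 lead tp2-p2x g12, who holds
23110); `--supports stmt-BirchSwinnertonDyer-23110`. THEOREMS ONLY (no definition, no named fact, no `sorry`); closes nothing.

WHY (memo ALL-RANK-RLF-ROADS-w4g0 §4). After `𝔖⁺_∞ = 0` (previous file of this seat: `…UniversalNormTowerVanishing`, p653237, the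
tower-vanishing lemma run on Kato's pin `𝐇¹_Γ(T_pE)` — norm-compatible `T_pE`-adic families in `γ`-stable bounded-rank
`ℤ_p`-submodules of torsion-free layers vanish), SURJ⁺@2 is reached by Poitou–Tate at a FINITE layer `ℚ_j` with FINITE coefficients
`E[p^j]`: a family of local classes at layer `n₀`, `p^{k₀}`-torsion, lifts to a global relaxed-Selmer class as soon as it is orthogonal
(local Tate duality, `res`/`cor` adjointness) to `loc` of the image of the transition `Sel⁺(ℚ_j, E[p^j]) → Sel⁺(ℚ_{n₀}, E[p^{k₀}])`
(`Cor ∘ p^{j−k₀}_*`) — so what the Poitou–Tate step consumes is «for every `(n₀, k₀)` some transition from a level `(j, j)` is ZERO».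
THIS FILE derives exactly that from the engine, in the currency of the tree's double tower `H¹(ℚ_n, E[p^k])`
(`WeierstrassCurve.torsionH1Over`, transitions `reduceTorsionH1` = `p_*` in `k` and `Kato2004.layerCores` = trace in `n`):

* `compatible_eq_zero` — let `C n k ≤ H¹(ℚ_n, E[p^k])` be subgroups stable under `conj_γ`; assume the layers `H¹(ℚ_n, T_pE)` have
  no `p`-torsion and the RANK BOUND «every `ℤ_p`-linearly independent family `y_1, …, y_m ∈ H¹(ℚ_n, T_pE)` whose reductions
  `red_{p^k} y_i` all lie in the `C n k` has `m ≤ B`» (uniform in `n`). Then every DOUBLY COMPATIBLE family `c_{n,k} ∈ C n k`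
  (`p_* c_{n,k+1} = c_{n,k}`, `Cor c_{n+1,k} = c_{n,k}`) is identically `0`. Proof: by Rubin B.2.3 + separatedness
  (`Kato2004.exists_normCompatible_of_compatible`, tree theorem) the family is `(red_{p^k} y_n)` for a norm-compatible `T_pE`-adic
  family `y`, which lies in the `ℤ_p`-submodules `S n = {y | ∀ k, red_{p^k} y ∈ C n k}` (submodules by the semilinearity
  `reduceH1Pk_smul`, `γ`-stable by `reduceH1Pk_conjMap`, of rank `≤ B` by `Module.rank_le`); the engine
  `forall_eq_zero_of_layerCores_eq_of_mem_of_rank_le` (Lemma 8.5 (2) + Kato's pin + Thm. 12.4 (2) + tower vanishing) kills `y`.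
* `exists_transition_eq_zero` — if moreover the `C n k` are FINITE and mapped into each other by `p_*` and `Cor`, then for every
  `(n₀, k₀)` and every TRANSITION SYSTEM `T n k : H¹(ℚ_n, E[p^k]) → H¹(ℚ_{n₀}, E[p^{k₀}])` (`T n₀ k₀ = id`, and on the quadrant
  `n ≥ n₀, k ≥ k₀`: `T n (k+1) = T n k ∘ p_*`, `T (n+1) k = T n k ∘ Cor` — e.g. `Cor_{n→n₀} ∘ p^{k−k₀}_*`, realised by the consumer)
  there is `j ≥ n₀, k₀` with `T j j = 0` on `C j j`. Proof: otherwise the finite sets `{x ∈ C n k | T n k x ≠ 0 on the quadrant}`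
  form a tower with non-empty diagonal, and Kőnig's lemma for the double tower (`Kato2004.exists_compatible_of_finite_nonempty`,
  tree theorem) produces a doubly compatible family in `C` with `c_{n₀,k₀} ≠ 0`, contradicting `compatible_eq_zero`.
* `exists_transition_eq_zero_of_goodSS` — `p = 2`, `E` globally minimal with good supersingular reduction at `2`: the torsion-freeness
  of the layers discharged (`layerH1_eq_zero_of_pow_smul_eq_zero_of_goodSS`, p645404); displayed inputs = the finite `γ`-stable
  `p_*`/`Cor`-stable level groups `C` and the rank bound `B`.

With `C n k := Sel⁺(ℚ_n, E[2^k])` (finite; `γ`-, `p_*`-, `Cor`-stable; rank bound `B = λ⁺` = the compact form of (Λ3)) this is the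
Mittag-Leffler input of the Poitou–Tate step; that instantiation and the Poitou–Tate step are NOT done here. HONEST FRAMING: closes
nothing; 23110 is NOT proved; BSD is not proved by any of this.
References: [Rubin2000] App. B Prop. B.2.3, §B.3; [Kato2004Asterisque] §8.2, Lemma 8.5 (2), §12.2, Thm. 12.4 (2); [GreenbergVatsal2000]
§2 Prop. (2.1); [PerrinRiou1987BSMF] §0 (the transition maps `p_*`); [NeukirchSchmidtWingberg2008] Ch. V §3.
-/

set_option autoImplicit false
-- D-0017: single-problem summit, so `Summit.BirchSwinnertonDyer.BirchSwinnertonDyer.…` repeats a namespace BY DESIGN.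
set_option linter.dupNamespace false

noncomputable section

open Field CategoryTheory
open Literature.NumberTheory.GaloisRepresentations
open Literature.NumberTheory.EllipticCurves Literature.NumberTheory.EllipticCurves.Kato2004
open Literature.NumberTheory.EllipticCurves.Kato2004.EulerSystemValues
open WeierstrassCurve (geomTorsion)

namespace Summit.BirchSwinnertonDyer.BirchSwinnertonDyer.Theorems.ResidualThetaLayer.TowerVanishing

variable {p : ℕ} [Fact p.Prime]

section AnyPrime

variable {W : WeierstrassCurve ℚ} [W.IsElliptic] [ContinuousSMul ℤ_[p] (W.tateModule p)]
  {κ : ZpExtension ℚ p} {γ : absoluteGaloisGroup ℚ}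

/-- **Doubly compatible families in a `γ`-stable bounded-rank tower of level groups vanish.** Let `E/ℚ`, `p`, `κ` the cyclotomic
`ℤ_p`-extension with topological generator `γ`, and `C n k ≤ H¹(ℚ_n, E[p^k])` subgroups stable under `conj_γ`; assume the layers
`H¹(ℚ_n, T_pE)` have no `p`-torsion and that every `ℤ_p`-linearly independent family in `H¹(ℚ_n, T_pE)` whose reductions modulo
every `p^k` lie in the `C n k` has at most `B` members. Then every family `c_{n,k} ∈ C n k` compatible under `p_*` (in `k`) and
under the trace maps (in `n`) is `0`. (Rubin B.2.3 lifts it to a norm-compatible `T_pE`-adic family — tree theorem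
`exists_normCompatible_of_compatible` — which the engine `forall_eq_zero_of_layerCores_eq_of_mem_of_rank_le` kills.)
[cite: Rubin2000, App. B Prop. B.2.3] [cite: Kato2004Asterisque, Lemma 8.5 (2) (p. 183) and Thm. 12.4 (2) (p. 221)]
[cite: GreenbergVatsal2000, §2 Prop. (2.1)] -/
theorem compatible_eq_zero (hκ : κ.IsCyclotomic) (hγ : κ.IsTopGenerator γ)
    (C : ∀ n k : ℕ, AddSubgroup (W.torsionH1Over ((p : ℤ) ^ k) (κ.layerSubgroup n)))
    (hCγ : ∀ (n k : ℕ) (x : W.torsionH1Over ((p : ℤ) ^ k) (κ.layerSubgroup n)), x ∈ C n k →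
      Literature.NumberTheory.EllipticCurves.conjH1 (κ.layerSubgroup n) (geomTorsion W ((p : ℤ) ^ k)) γ x ∈ C n k)
    (htf : ∀ (n k : ℕ) (y : H1 (tateRep W p) (κ.layerSubgroup n)), ((p : ℤ_[p]) ^ k) • y = 0 → y = 0)
    (B : ℕ)
    (hB : ∀ (n m : ℕ) (v : Fin m → H1 (tateRep W p) (κ.layerSubgroup n)),
      (∀ i k, reduceH1Pk W p k (κ.layerSubgroup n) (v i) ∈ C n k) → LinearIndependent ℤ_[p] v → m ≤ B)
    (c : ∀ n k : ℕ, W.torsionH1Over ((p : ℤ) ^ k) (κ.layerSubgroup n)) (hc : ∀ n k, c n k ∈ C n k)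
    (hk : ∀ n k, W.reduceTorsionH1 p k (κ.layerSubgroup n) (c n (k + 1)) = c n k)
    (hn : ∀ n k, layerCores (W.torsionGaloisModule ((p : ℤ) ^ k)) κ n (c (n + 1) k) = c n k)
    (n k : ℕ) : c n k = 0 := by
  classical
  -- Rubin B.2.3: the family is the reduction of a norm-compatible `T_pW`-adic family `y`
  obtain ⟨y, hy, hcor⟩ := exists_normCompatible_of_compatible W p κ c hk hn
  -- the `ℤ_p`-submodules `S n = {y | ∀ k, red_{p^k} y ∈ C n k}`
  let S : ∀ n : ℕ, Submodule ℤ_[p] (H1 (tateRep W p) (κ.layerSubgroup n)) := fun n ↦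
    { carrier := {y | ∀ k, reduceH1Pk W p k (κ.layerSubgroup n) y ∈ C n k}
      zero_mem' := fun k ↦ by rw [map_zero]; exact (C n k).zero_mem
      add_mem' := fun {a b} ha hb k ↦ by rw [map_add]; exact (C n k).add_mem (ha k) (hb k)
      smul_mem' := fun a y hy k ↦ by
        rw [reduceH1Pk_smul]
        exact (C n k).zsmul_mem (hy k) _ }
  have hSmem : ∀ (n : ℕ) (y : H1 (tateRep W p) (κ.layerSubgroup n)),
      y ∈ S n ↔ ∀ k, reduceH1Pk W p k (κ.layerSubgroup n) y ∈ C n k := fun n y ↦ Iff.rfl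
  -- `γ`-stability (`red` commutes with `conj_γ`)
  have hS : ∀ (n : ℕ) (y : H1 (tateRep W p) (κ.layerSubgroup n)), y ∈ S n →
      conjMap (tateRep W p).toTopRep (κ.layerSubgroup n) γ 1 y ∈ S n := fun n y hy ↦
    (hSmem n _).mpr fun k ↦ by
      rw [reduceH1Pk_conjMap]
      exact hCγ n k _ ((hSmem n y).mp hy k)
  -- the rank bound
  have hrank : ∀ n, Module.rank ℤ_[p] (S n) ≤ B := fun n ↦ by
    refine rank_le fun s hs ↦ ?_
    let e := s.equivFin
    have hli : LinearIndependent ℤ_[p]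
        (fun j : Fin s.card ↦ (((e.symm j : s) : S n) : H1 (tateRep W p) (κ.layerSubgroup n))) :=
      (hs.comp e.symm e.symm.injective).map' (S n).subtype (Submodule.ker_subtype _)
    exact hB n s.card _ (fun j k ↦ (hSmem n _).mp ((e.symm j : s) : S n).2 k) hli
  -- the engine
  have hyS : ∀ m, y m ∈ S m := fun m ↦ (hSmem m _).mpr fun k ↦ by
    rw [hy]
    exact hc m k
  have h0 : y n = 0 := forall_eq_zero_of_layerCores_eq_of_mem_of_rank_le hκ hγ S hS htf B hrank y hcor hyS n
  rw [← hy n k, h0, map_zero]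
  rfl

/-- **Mittag-Leffler / Kőnig: some transition from a high level is the zero map.** In the situation of `compatible_eq_zero`, assume
moreover that the level groups `C n k ≤ H¹(ℚ_n, E[p^k])` are FINITE and mapped into each other by `p_*` and by the trace maps. Let
`T n k : H¹(ℚ_n, E[p^k]) → H¹(ℚ_{n₀}, E[p^{k₀}])` be any transition system to the level `(n₀, k₀)`: `T n₀ k₀ = id` and, on the quadrant
`n ≥ n₀`, `k ≥ k₀`, `T n (k+1) = T n k ∘ p_*` and `T (n+1) k = T n k ∘ Cor` (e.g. `Cor_{ℚ_n/ℚ_{n₀}} ∘ p^{k−k₀}_*`). Then for some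
`j ≥ n₀, k₀` the transition `T j j` vanishes on `C j j`. Otherwise the finite sets `{x ∈ C n k | T n k x ≠ 0}` (condition imposed on
the quadrant only) form a `p_*`/`Cor`-stable tower with non-empty diagonal, Kőnig's lemma (`exists_compatible_of_finite_nonempty`)
gives a doubly compatible family in `C` with `c_{n₀,k₀} ≠ 0`, contradicting `compatible_eq_zero`.
[cite: Rubin2000, App. B §B.3 (p. 228)] [cite: NeukirchSchmidtWingberg2008, Ch. V §3] [cite: GreenbergVatsal2000, §2 Prop. (2.1)] -/
theorem exists_transition_eq_zero (hκ : κ.IsCyclotomic) (hγ : κ.IsTopGenerator γ)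
    (C : ∀ n k : ℕ, AddSubgroup (W.torsionH1Over ((p : ℤ) ^ k) (κ.layerSubgroup n)))
    (hCγ : ∀ (n k : ℕ) (x : W.torsionH1Over ((p : ℤ) ^ k) (κ.layerSubgroup n)), x ∈ C n k →
      Literature.NumberTheory.EllipticCurves.conjH1 (κ.layerSubgroup n) (geomTorsion W ((p : ℤ) ^ k)) γ x ∈ C n k)
    (hCfin : ∀ n k, (C n k : Set (W.torsionH1Over ((p : ℤ) ^ k) (κ.layerSubgroup n))).Finite)
    (hCk : ∀ (n k : ℕ) (x : W.torsionH1Over ((p : ℤ) ^ (k + 1)) (κ.layerSubgroup n)), x ∈ C n (k + 1) →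
      W.reduceTorsionH1 p k (κ.layerSubgroup n) x ∈ C n k)
    (hCn : ∀ (n k : ℕ) (x : W.torsionH1Over ((p : ℤ) ^ k) (κ.layerSubgroup (n + 1))), x ∈ C (n + 1) k →
      layerCores (W.torsionGaloisModule ((p : ℤ) ^ k)) κ n x ∈ C n k)
    (htf : ∀ (n k : ℕ) (y : H1 (tateRep W p) (κ.layerSubgroup n)), ((p : ℤ_[p]) ^ k) • y = 0 → y = 0)
    (B : ℕ)
    (hB : ∀ (n m : ℕ) (v : Fin m → H1 (tateRep W p) (κ.layerSubgroup n)),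
      (∀ i k, reduceH1Pk W p k (κ.layerSubgroup n) (v i) ∈ C n k) → LinearIndependent ℤ_[p] v → m ≤ B)
    (n₀ k₀ : ℕ)
    (T : ∀ n k : ℕ, W.torsionH1Over ((p : ℤ) ^ k) (κ.layerSubgroup n) →
      W.torsionH1Over ((p : ℤ) ^ k₀) (κ.layerSubgroup n₀))
    (hT0 : ∀ x, T n₀ k₀ x = x)
    (hTk : ∀ (n k : ℕ) (x : W.torsionH1Over ((p : ℤ) ^ (k + 1)) (κ.layerSubgroup n)), n₀ ≤ n → k₀ ≤ k →
      T n (k + 1) x = T n k (W.reduceTorsionH1 p k (κ.layerSubgroup n) x))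
    (hTn : ∀ (n k : ℕ) (x : W.torsionH1Over ((p : ℤ) ^ k) (κ.layerSubgroup (n + 1))), n₀ ≤ n → k₀ ≤ k →
      T (n + 1) k x = T n k (layerCores (W.torsionGaloisModule ((p : ℤ) ^ k)) κ n x)) :
    ∃ j : ℕ, n₀ ≤ j ∧ k₀ ≤ j ∧ ∀ x ∈ C j j, T j j x = 0 := by
  classical
  by_contra H
  push Not at H
  -- the bad tower: classes of `C` whose transition to `(n₀, k₀)` is non-zero (condition on the quadrant only)
  let S : ∀ n k : ℕ, Set (W.torsionH1Over ((p : ℤ) ^ k) (κ.layerSubgroup n)) := fun n k ↦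
    {x | x ∈ C n k ∧ (n₀ ≤ n → k₀ ≤ k → T n k x ≠ 0)}
  have hSfin : ∀ n k, (S n k).Finite := fun n k ↦ (hCfin n k).subset fun x hx ↦ hx.1
  have hSne : ∀ j, (S j j).Nonempty := fun j ↦ by
    by_cases hj : n₀ ≤ j ∧ k₀ ≤ j
    · obtain ⟨x, hxC, hxT⟩ := H j hj.1 hj.2
      exact ⟨x, hxC, fun _ _ ↦ hxT⟩
    · exact ⟨0, (C j j).zero_mem, fun h1 h2 ↦ (hj ⟨h1, h2⟩).elim⟩
  have hSk : ∀ n k, ∀ x ∈ S n (k + 1), W.reduceTorsionH1 p k (κ.layerSubgroup n) x ∈ S n k := by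
    rintro n k x ⟨hxC, hxT⟩
    refine ⟨hCk n k x hxC, fun h1 h2 ↦ ?_⟩
    rw [← hTk n k x h1 h2]
    exact hxT h1 (h2.trans (Nat.le_succ k))
  have hSn : ∀ n k, ∀ x ∈ S (n + 1) k,
      layerCores (W.torsionGaloisModule ((p : ℤ) ^ k)) κ n x ∈ S n k := by
    rintro n k x ⟨hxC, hxT⟩
    refine ⟨hCn n k x hxC, fun h1 h2 ↦ ?_⟩
    rw [← hTn n k x h1 h2]
    exact hxT (h1.trans (Nat.le_succ n)) h2
  -- Kőnig: a doubly compatible family through the bad tower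
  obtain ⟨c, hcS, hck, hcn⟩ := exists_compatible_of_finite_nonempty W p κ S hSfin hSne hSk hSn
  -- it vanishes by `compatible_eq_zero`, yet its `(n₀, k₀)` entry is non-zero
  have h0 : c n₀ k₀ = 0 :=
    compatible_eq_zero hκ hγ C hCγ htf B hB c (fun n k ↦ (hcS n k).1) hck hcn n₀ k₀
  have hne : T n₀ k₀ (c n₀ k₀) ≠ 0 := (hcS n₀ k₀).2 le_rfl le_rfl
  rw [hT0, h0] at hne
  exact hne rfl

end AnyPrime

/-- **Mittag-Leffler vanishing at `p = 2` on the habitat.** For `E/ℚ` globally minimal with good supersingular reduction at `2`, the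
cyclotomic `ℤ₂`-extension `κ` with topological generator `γ`, and finite level groups `C n k ≤ H¹(ℚ_n, E[2^k])` stable under
`conj_γ`, `2_*` and the trace maps, whose `T₂E`-adic hulls have `ℤ₂`-rank `≤ B` (every independent family in `H¹(ℚ_n, T₂E)` reducing
into the `C n k` has `≤ B` members): for every `(n₀, k₀)` and every transition system `T` to `(n₀, k₀)` some `T j j`, `j ≥ n₀, k₀`,
vanishes on `C j j` — the torsion-freeness of the layers `H¹(ℚ_n, T₂E)` being automatic (`E(ℚ_∞)[2^∞] = 0`,
`layerH1_eq_zero_of_pow_smul_eq_zero_of_goodSS`). With `C n k = Sel⁺(ℚ_n, E[2^k])` and `B = λ⁺` this is the Mittag-Leffler input of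
the layer Poitou–Tate step to SURJ⁺@2 (item 23110 at every rank); that instantiation is not made here.
[cite: GreenbergVatsal2000, §2 Prop. (2.1)] [cite: Rubin2000, App. B Prop. B.2.3 and §B.3] [cite: Kato2004Asterisque, Thm. 12.4 (2)] -/
theorem exists_transition_eq_zero_of_goodSS {W : WeierstrassCurve ℚ} [W.IsElliptic] [W.IsGloballyMinimal]
    [ContinuousSMul ℤ_[2] (W.tateModule 2)] (hss : Rank1Residual.GoodSS W 2)
    {κ : ZpExtension ℚ 2} {γ : absoluteGaloisGroup ℚ} (hκ : κ.IsCyclotomic) (hγ : κ.IsTopGenerator γ)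
    (C : ∀ n k : ℕ, AddSubgroup (W.torsionH1Over ((2 : ℤ) ^ k) (κ.layerSubgroup n)))
    (hCγ : ∀ (n k : ℕ) (x : W.torsionH1Over ((2 : ℤ) ^ k) (κ.layerSubgroup n)), x ∈ C n k →
      Literature.NumberTheory.EllipticCurves.conjH1 (κ.layerSubgroup n) (geomTorsion W ((2 : ℤ) ^ k)) γ x ∈ C n k)
    (hCfin : ∀ n k, (C n k : Set (W.torsionH1Over ((2 : ℤ) ^ k) (κ.layerSubgroup n))).Finite)
    (hCk : ∀ (n k : ℕ) (x : W.torsionH1Over ((2 : ℤ) ^ (k + 1)) (κ.layerSubgroup n)), x ∈ C n (k + 1) →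
      W.reduceTorsionH1 2 k (κ.layerSubgroup n) x ∈ C n k)
    (hCn : ∀ (n k : ℕ) (x : W.torsionH1Over ((2 : ℤ) ^ k) (κ.layerSubgroup (n + 1))), x ∈ C (n + 1) k →
      layerCores (W.torsionGaloisModule ((2 : ℤ) ^ k)) κ n x ∈ C n k)
    (B : ℕ)
    (hB : ∀ (n m : ℕ) (v : Fin m → H1 (tateRep W 2) (κ.layerSubgroup n)),
      (∀ i k, reduceH1Pk W 2 k (κ.layerSubgroup n) (v i) ∈ C n k) → LinearIndependent ℤ_[2] v → m ≤ B)
    (n₀ k₀ : ℕ)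
    (T : ∀ n k : ℕ, W.torsionH1Over ((2 : ℤ) ^ k) (κ.layerSubgroup n) →
      W.torsionH1Over ((2 : ℤ) ^ k₀) (κ.layerSubgroup n₀))
    (hT0 : ∀ x, T n₀ k₀ x = x)
    (hTk : ∀ (n k : ℕ) (x : W.torsionH1Over ((2 : ℤ) ^ (k + 1)) (κ.layerSubgroup n)), n₀ ≤ n → k₀ ≤ k →
      T n (k + 1) x = T n k (W.reduceTorsionH1 2 k (κ.layerSubgroup n) x))
    (hTn : ∀ (n k : ℕ) (x : W.torsionH1Over ((2 : ℤ) ^ k) (κ.layerSubgroup (n + 1))), n₀ ≤ n → k₀ ≤ k →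
      T (n + 1) k x = T n k (layerCores (W.torsionGaloisModule ((2 : ℤ) ^ k)) κ n x)) :
    ∃ j : ℕ, n₀ ≤ j ∧ k₀ ≤ j ∧ ∀ x ∈ C j j, T j j x = 0 :=
  exists_transition_eq_zero (p := 2) hκ hγ C hCγ hCfin hCk hCn
    (fun n k y hy ↦ layerH1_eq_zero_of_pow_smul_eq_zero_of_goodSS hss κ n k y (by exact_mod_cast hy)) B hB n₀ k₀ T hT0
    hTk hTn

end Summit.BirchSwinnertonDyer.BirchSwinnertonDyer.Theorems.ResidualThetaLayer.TowerVanishing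

end
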